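import Literature.NumberTheory.Sieve.GoldbachLinnikParseval
import Literature.NumberTheory.Sieve.PintzRuzsa2003SingularSums
import Literature.NumberTheory.Sieve.PrimePairsLinearSieveUpper
import HarnessLib

/-!
# Pintz–Ruzsa I, Lemma 10 with the sieve constant `4`: the mean value `∫₀¹ |S(α)G(α)|² dα`

Topic `Literature/NumberTheory/Sieve`; support file for the named fact
`Literature.NumberTheory.Sieve.goldbach_linnik` (parity.S36), in the vocabulary of
`GoldbachLinnikParseval.lean` (`GoldbachLinnik.primeSum = S`, `GoldbachLinnik.powSum = G`,
`GoldbachLinnik.powLen = L = [log₂ N]`). Everything here is PROVED; no named fact is introduced or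
assumed, and no numerical value of `R₀` is asserted.

J. Pintz, I. Z. Ruzsa, *On Linnik's approximation to Goldbach's problem, I*, Acta Arith. 109 (2003),
§8, **Lemma 10**: unconditionally

  `s(N) = ∫₀¹ |S(α)G(α)|² dα ≤ (2/log² 2) C₂ N`,  `C₂ = C₀R₀C + (log 2)/2 + ε < 5.3636`,

with `C₀ = C₂` the twin prime constant, `R₀` Romanov's constant ((8.14), `R₀ < 1.94`) and `C = 3.9171`
Chen's prime-pair constant (Lemma 3). This file proves the theorem with the sieve constant `C = 4`
of the tree (`PrimePairSieve.primePairs_card_le_four`, Bombieri–Davenport/linear sieve, uniform in the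
shift) in place of Chen's `3.9171`, in the normalisation `2NL²/log² N ∼ 2N/log² 2`:

* `PintzRuzsa2003.lemma10_four`: for every `ε > 0` and all large `N`,
  `∫₀¹ |S(α)G(α)|² dα ≤ (4 C₀ R₀ + (log 2)/2 + ε) · 2N L²/log² N`, `R₀ = PintzRuzsa2003.romanovConstPR`.

The proof is the printed one ((8.3)–(8.4) Parseval: `integral_norm_sq_primeSum_mul_powSum`, `s(N)` as
the coincidence count `sgCoincidences`; (8.7): the fibre over `(m₁, m₂)` is a prime-pair count `R(h)`,
`h = 2^{m₂} - 2^{m₁}` (`card_primePairsShift_le_card_filter`), the diagonal is `≤ L π(N)`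
(`card_oddPrimePairsShift_self_le`); (8.8)–(8.14): `2 ∑_{m₁<m₂} f(2^{m₂} - 2^{m₁}) ≤ L² R₀`,
`PintzRuzsa2003.sum_pairs_fWeight_le` of `PintzRuzsa2003SingularSums.lean`; (8.15): the prime number
theorem for `L π(N)`, here through `π(N) log N/N → 1` and `log N/L → log 2`, `tendsto_log_div_powLen`).

Role downstream: Lemma 10 is the whole-circle mean value; the minor-arc version Lemma 11
(`∫_{C(𝔐)} |SG|² ≤ 2C₂' N/log² 2` with `C₂' = C₀R₀(C-1) + …`), used in (10.5), subtracts the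
major-arc contribution and needs the major-arc asymptotics (their Lemma 1; unconditionally Part II) —
NOT treated here.

## References

* J. Pintz, I. Z. Ruzsa, *On Linnik's approximation to Goldbach's problem, I*, Acta Arith. 109
  (2003) 169–194, §8 (8.2)–(8.15), Lemma 10. [PintzRuzsa2003]
-/

noncomputable section

open scoped FourierTransform

open Finset Filter MeasureTheory Topology

namespace Literature.NumberTheory.Sieve

namespace PintzRuzsa2003

open GoldbachLinnik Romanov

/-! ### Parseval: `∫₀¹ |S G|² = s(N)` -/

/-- The index set `{(p, m) : p ≤ N odd prime, 1 ≤ m ≤ L}` of `S(α)G(α)`. [cite: PintzRuzsa2003, §8 (8.1)–(8.4)] -/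
def sgIndex (N : ℕ) : Finset (ℕ × ℕ) := oddPrimes N ×ˢ Finset.Icc 1 (powLen N)

/-- `S(α) G(α) = ∑_{(p, m)} e((p + 2^m) α)`. [cite: PintzRuzsa2003, §8 (8.4)] -/
theorem primeSum_mul_powSum (N : ℕ) (α : ℝ) :
    primeSum N α * powSum N α = ∑ x ∈ sgIndex N, (𝐞 (((x.1 + 2 ^ x.2 : ℕ) : ℝ) * α) : ℂ) := by
  unfold primeSum powSum sgIndex
  rw [Finset.sum_mul_sum, ← Finset.sum_product']
  refine Finset.sum_congr rfl fun x _ => ?_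
  rw [← fourierChar_add_coe]
  congr 2
  push_cast
  ring

/-- The coincidences `(p₁, m₁; p₂, m₂)` with `p₁ + 2^{m₁} = p₂ + 2^{m₂}` — Pintz–Ruzsa's `s(N)`
((8.2), with odd primes as printed). [cite: PintzRuzsa2003, §8 (8.2)] -/
def sgCoincidences (N : ℕ) : Finset ((ℕ × ℕ) × (ℕ × ℕ)) :=
  (sgIndex N ×ˢ sgIndex N).filter fun z => z.1.1 + 2 ^ z.1.2 = z.2.1 + 2 ^ z.2.2

/-- **(8.3)–(8.4)**: `∫₀¹ |S(α)G(α)|² dα = s(N)`. [cite: PintzRuzsa2003, §8 (8.3)–(8.4)] -/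
theorem integral_norm_sq_primeSum_mul_powSum (N : ℕ) :
    ∫ α in (0 : ℝ)..1, ‖primeSum N α * powSum N α‖ ^ 2 = ((sgCoincidences N).card : ℝ) := by
  simp_rw [primeSum_mul_powSum]
  rw [integral_norm_sq_expSum]
  rfl

/-! ### `s(N)` fibred over the exponent pairs -/

/-- The prime fibre over `(m₁, m₂)`: odd prime pairs with `p₁ + 2^{m₁} = p₂ + 2^{m₂}`. [cite: PintzRuzsa2003, §8 (8.2)] -/
def oddPrimePairsShift (N m₁ m₂ : ℕ) : Finset (ℕ × ℕ) :=
  (oddPrimes N ×ˢ oddPrimes N).filter fun q => q.1 + 2 ^ m₁ = q.2 + 2 ^ m₂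

/-- `s(N) = ∑_{(m₁, m₂) ∈ [1,L]²} #(fibre)`. [folklore] -/
theorem card_sgCoincidences_eq_sum (N : ℕ) :
    (sgCoincidences N).card =
      ∑ m ∈ Finset.Icc 1 (powLen N) ×ˢ Finset.Icc 1 (powLen N), (oddPrimePairsShift N m.1 m.2).card := by
  classical
  -- regroup `((p₁,m₁),(p₂,m₂)) ↦ ((p₁,p₂),(m₁,m₂))`
  set Q : Finset ((ℕ × ℕ) × (ℕ × ℕ)) :=
    ((oddPrimes N ×ˢ oddPrimes N) ×ˢ (Finset.Icc 1 (powLen N) ×ˢ Finset.Icc 1 (powLen N))).filter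
      fun q => q.1.1 + 2 ^ q.2.1 = q.1.2 + 2 ^ q.2.2 with hQ
  have h1 : (sgCoincidences N).card = Q.card := by
    refine Finset.card_nbij' (fun z => ((z.1.1, z.2.1), (z.1.2, z.2.2))) (fun q => ((q.1.1, q.2.1), (q.1.2, q.2.2)))
      (fun z hz => ?_) (fun q hq => ?_) (fun _ _ => rfl) fun _ _ => rfl
    · simp only [sgCoincidences, sgIndex, Finset.mem_coe, Finset.mem_filter, Finset.mem_product] at hz
      simp only [hQ, Finset.mem_coe, Finset.mem_filter, Finset.mem_product]
      exact ⟨⟨⟨hz.1.1.1, hz.1.2.1⟩, hz.1.1.2, hz.1.2.2⟩, hz.2⟩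
    · simp only [hQ, Finset.mem_coe, Finset.mem_filter, Finset.mem_product] at hq
      simp only [sgCoincidences, sgIndex, Finset.mem_coe, Finset.mem_filter, Finset.mem_product]
      exact ⟨⟨⟨hq.1.1.1, hq.1.2.1⟩, hq.1.1.2, hq.1.2.2⟩, hq.2⟩
  rw [h1, hQ, Finset.card_filter, Finset.sum_product_right]
  refine Finset.sum_congr rfl fun m _ => ?_
  rw [oddPrimePairsShift, Finset.card_filter]

/-- The odd-prime fibre sits inside the all-prime fibre `Romanov.primePairsShift`. [folklore] -/
theorem oddPrimePairsShift_subset (N m₁ m₂ : ℕ) :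
    oddPrimePairsShift N m₁ m₂ ⊆ primePairsShift N m₁ m₂ := by
  intro q hq
  simp only [oddPrimePairsShift, Finset.mem_filter, Finset.mem_product, mem_oddPrimes] at hq
  simp only [primePairsShift, Finset.mem_filter, Finset.mem_product, Nat.mem_primesLE]
  exact ⟨⟨⟨hq.1.1.1, hq.1.1.2.1⟩, hq.1.2.1, hq.1.2.2.1⟩, hq.2⟩

/-- **Off-diagonal fibres inject into prime pairs**: for `m₁ < m₂`, `(p₁, p₂) ↦ p₂` maps the fibre
injectively into `{p ≤ N : p + h prime}`, `h = 2^{m₂} - 2^{m₁}`. [cite: PintzRuzsa2003, §8 (8.7)] -/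
theorem card_primePairsShift_le_card_filter {N m₁ m₂ : ℕ} (h12 : m₁ < m₂) :
    (primePairsShift N m₁ m₂).card ≤
      ((Nat.primesLE N).filter fun p => (p + (2 ^ m₂ - 2 ^ m₁)).Prime).card := by
  have hpow : 2 ^ m₁ < 2 ^ m₂ := Nat.pow_lt_pow_right (by norm_num) h12
  set h := 2 ^ m₂ - 2 ^ m₁ with hh
  refine Finset.card_le_card_of_injOn Prod.snd (fun q hq => ?_) fun q hq q' hq' heq => ?_
  · simp only [primePairsShift, Finset.mem_coe, Finset.mem_filter, Finset.mem_product] at hq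
    rw [Finset.mem_coe, Finset.mem_filter]
    refine ⟨hq.1.2, ?_⟩
    have : q.2 + h = q.1 := by have := hq.2; omega
    rw [this]
    exact (Nat.mem_primesLE.mp hq.1.1).2
  · simp only [primePairsShift, Finset.mem_coe, Finset.mem_filter, Finset.mem_product] at hq hq'
    have e1 : q.1 = q.2 + h := by have := hq.2; omega
    have e2 : q'.1 = q'.2 + h := by have := hq'.2; omega
    exact Prod.ext (by rw [e1, e2]; simpa using heq) heq

/-- Symmetry of the odd-prime fibres. [folklore] -/
theorem card_oddPrimePairsShift_comm (N m₁ m₂ : ℕ) :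
    (oddPrimePairsShift N m₁ m₂).card = (oddPrimePairsShift N m₂ m₁).card := by
  refine Finset.card_nbij' Prod.swap Prod.swap (fun q hq => ?_) (fun q hq => ?_) (fun _ _ => rfl) fun _ _ => rfl
  · simp only [oddPrimePairsShift, Finset.mem_coe, Finset.mem_filter, Finset.mem_product] at hq ⊢
    exact ⟨⟨hq.1.2, hq.1.1⟩, hq.2.symm⟩
  · simp only [oddPrimePairsShift, Finset.mem_coe, Finset.mem_filter, Finset.mem_product] at hq ⊢
    exact ⟨⟨hq.1.2, hq.1.1⟩, hq.2.symm⟩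

/-- The diagonal fibre: `p₁ = p₂`, at most `π(N)` pairs (PR: `R(0) = π(N)`). [cite: PintzRuzsa2003, §8 (8.7)] -/
theorem card_oddPrimePairsShift_self_le (N m : ℕ) :
    (oddPrimePairsShift N m m).card ≤ Nat.primeCounting N :=
  ((Finset.card_le_card (oddPrimePairsShift_subset N m m)).trans (card_primePairsShift_self_le N m)).trans
    (by rw [Nat.primesLE_card_eq_primeCounting])

/-! ### `log N / L → log 2` -/

/-- `log N / L → log 2` for `L = ⌊log₂ N⌋` (`2^L ≤ N < 2^{L+1}`). [folklore] -/
theorem tendsto_log_div_powLen :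
    Tendsto (fun N : ℕ => Real.log N / (powLen N : ℝ)) atTop (𝓝 (Real.log 2)) := by
  have hl2 : 0 < Real.log 2 := Real.log_pos one_lt_two
  -- squeeze between `log 2` and `log 2 · (1 + 1/L)`
  have hup : Tendsto (fun N : ℕ => Real.log 2 * (1 + 1 / (powLen N : ℝ))) atTop (𝓝 (Real.log 2)) := by
    have hL : Tendsto (fun N : ℕ => (powLen N : ℝ)) atTop atTop := by
      refine tendsto_natCast_atTop_atTop.comp ?_
      exact tendsto_atTop_atTop.mpr fun B => (eventually_atTop.mp (eventually_le_powLen B))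
    have h := (tendsto_const_nhds.div_atTop hL : Tendsto (fun N : ℕ => (1 : ℝ) / (powLen N : ℝ)) atTop (𝓝 0))
    have := (tendsto_const_nhds (x := Real.log 2)).mul ((tendsto_const_nhds (x := (1 : ℝ))).add h)
    simpa using this
  refine tendsto_of_tendsto_of_tendsto_of_le_of_le' tendsto_const_nhds hup ?_ ?_
  · filter_upwards [eventually_le_powLen 1, eventually_ge_atTop 1] with N hL hN
    have hN0 : N ≠ 0 := by omega
    have hLpos : (0 : ℝ) < powLen N := by exact_mod_cast hL
    rw [le_div_iff₀ hLpos]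
    have := natLog_two_le_log_div hN0
    rw [le_div_iff₀ hl2] at this
    simpa [powLen, mul_comm] using this
  · filter_upwards [eventually_le_powLen 1, eventually_ge_atTop 1] with N hL hN
    have hLpos : (0 : ℝ) < powLen N := by exact_mod_cast hL
    have hlt := Nat.lt_pow_succ_log_self (b := 2) (by norm_num) N
    have hN0 : (0 : ℝ) < N := by exact_mod_cast (by omega : 0 < N)
    have h1 : (N : ℝ) ≤ (2 : ℝ) ^ (powLen N + 1) := by unfold powLen; exact_mod_cast hlt.le
    have h2 := Real.log_le_log hN0 h1
    rw [Real.log_pow] at h2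
    push_cast at h2
    rw [div_le_iff₀ hLpos]
    have : Real.log 2 * (1 + 1 / (powLen N : ℝ)) * powLen N = (powLen N + 1) * Real.log 2 := by
      field_simp
    rw [this]
    exact h2

/-! ### Lemma 10 with `C = 4` -/

/-- **Pintz–Ruzsa I, Lemma 10, with the sieve constant `4` in place of Chen's `3.9171`.** For every
`ε > 0` and all large `N`,
`∫₀¹ |S(α)G(α)|² dα = s(N) ≤ (4 C₀ R₀ + (log 2)/2 + ε) · 2 N L²/log² N`
(`C₀ = C₂ = Literature.twinPrimeConst`, `R₀ = romanovConstPR`, `L = [log₂ N]`; Pintz–Ruzsa: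
`s(N) ≤ (2/log² 2)(C₀R₀C + (log 2)/2 + ε) N` with `C = 3.9171`, i.e. `C₂ < 5.3636` — here the
bracket is `< 0.6602 · 1.94 · 4 + 0.3466 < 5.47` once `R₀ < 1.94` is granted, which is NOT asserted).
Proof as printed ((8.7), (8.15)): diagonal `m₁ = m₂` contributes `≤ L π(N) ≤ ((log 2)/2 + ε/2) 2NL²/log² N`
(prime number theorem and `log N/L → log 2`); off the diagonal the fibre over `(m₁, m₂)` is at most
`R(h) ≤ (4 + ε₁) · 2C₀ f(h) N/log² N`, `h = 2^{m₂} - 2^{m₁}`, by the uniform prime-pair sieve bound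
`PrimePairSieve.primePairs_card_le_four`, and `2 ∑_{m₁<m₂} f(2^{m₂} - 2^{m₁}) ≤ L² R₀`
(`sum_pairs_fWeight_le`). [cite: PintzRuzsa2003, §8 Lemma 10] -/
theorem lemma10_four (ε : ℝ) (hε : 0 < ε) :
    ∀ᶠ N : ℕ in atTop,
      ∫ α in (0 : ℝ)..1, ‖primeSum N α * powSum N α‖ ^ 2 ≤
        (4 * twinPrimeConst * romanovConstPR + Real.log 2 / 2 + ε) *
          (2 * (N : ℝ) * (powLen N : ℝ) ^ 2 / Real.log N ^ 2) := by
  have hC2 : 0 < twinPrimeConst := twinPrimeConst_pos_holds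
  have hR0 : 0 ≤ romanovConstPR := romanovConstPR_nonneg
  have hl2 : 0 < Real.log 2 := Real.log_pos one_lt_two
  set K : ℝ := twinPrimeConst * romanovConstPR with hK
  have hK0 : 0 ≤ K := by positivity
  -- the sieve, with `ε₁ K ≤ ε/2`
  set ε₁ : ℝ := ε / (2 * K + 2) with hε₁
  have hε₁0 : 0 < ε₁ := by positivity
  have hε₁K : ε₁ * K ≤ ε / 2 := by
    rw [hε₁, div_mul_eq_mul_div, div_le_iff₀ (by positivity)]
    nlinarith
  have hsieve := PrimePairSieve.primePairs_card_le_four ε₁ hε₁0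
  -- the diagonal, through `π(N) log N / N · (log N / L) → log 2`
  have hratio : Tendsto (fun N : ℕ => (Nat.primeCounting N : ℝ) * Real.log N / N *
      (Real.log N / (powLen N : ℝ))) atTop (𝓝 (Real.log 2)) := by
    have h := Literature.NumberTheory.Sieve.tendsto_primeCounting_mul_log_div.mul tendsto_log_div_powLen
    rwa [one_mul] at h
  have hdiag := hratio.eventually (gt_mem_nhds (show Real.log 2 < Real.log 2 + ε by linarith))
  filter_upwards [hsieve, hdiag, eventually_le_powLen 1, eventually_ge_atTop 2] with N hSv hDg hL1 hN2
  set L := powLen N with hLdef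
  have hN0 : (0 : ℝ) < N := by exact_mod_cast (by omega : 0 < N)
  have hN1 : (1 : ℝ) < N := by exact_mod_cast (by omega : 1 < N)
  have hlogN : 0 < Real.log N := Real.log_pos hN1
  have hLpos : (0 : ℝ) < L := by exact_mod_cast hL1
  set W : ℝ := (N : ℝ) / Real.log N ^ 2 with hW
  have hW0 : 0 ≤ W := by positivity
  -- fibre bounds
  have hoff : ∀ m ∈ (Finset.Icc 1 L ×ˢ Finset.Icc 1 L).filter (fun m : ℕ × ℕ => m.1 < m.2),
      ((oddPrimePairsShift N m.1 m.2).card : ℝ) ≤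
        (4 + ε₁) * 2 * twinPrimeConst * fWeight (2 ^ m.2 - 2 ^ m.1) * W := by
    intro m hm
    simp only [Finset.mem_filter, Finset.mem_product, Finset.mem_Icc] at hm
    obtain ⟨⟨⟨hm1, -⟩, -, -⟩, h12⟩ := hm
    have hpow : 2 ^ m.1 < 2 ^ m.2 := Nat.pow_lt_pow_right (by norm_num) h12
    set h := 2 ^ m.2 - 2 ^ m.1 with hh
    have hh0 : h ≠ 0 := by omega
    have hheven : Even h := by
      rw [hh]
      refine Nat.even_sub hpow.le |>.mpr ?_
      simp [Nat.even_pow, (show m.1 ≠ 0 by omega), (show m.2 ≠ 0 by omega)]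
    calc ((oddPrimePairsShift N m.1 m.2).card : ℝ)
        ≤ ((primePairsShift N m.1 m.2).card : ℝ) := by
          exact_mod_cast Finset.card_le_card (oddPrimePairsShift_subset N m.1 m.2)
      _ ≤ (((Nat.primesLE N).filter fun p => (p + h).Prime).card : ℝ) := by
          exact_mod_cast card_primePairsShift_le_card_filter h12
      _ ≤ (4 + ε₁) * 2 * Chen.singularSeries h * N / Real.log N ^ 2 := hSv h hheven hh0
      _ = (4 + ε₁) * 2 * twinPrimeConst * fWeight (2 ^ m.2 - 2 ^ m.1) * W := by
          rw [singularSeries_eq_twinPrimeConst_mul_fWeight, hW]; ring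
  -- splitting the exponent square
  set P := Finset.Icc 1 L ×ˢ Finset.Icc 1 L with hP
  set c : ℕ × ℕ → ℝ := fun m => ((oddPrimePairsShift N m.1 m.2).card : ℝ) with hc
  have hsplit : ∑ m ∈ P, c m =
      ∑ m ∈ P.filter (fun m => m.1 < m.2), c m + ∑ m ∈ P.filter (fun m => m.1 = m.2), c m +
        ∑ m ∈ P.filter (fun m => m.2 < m.1), c m := by
    rw [← Finset.sum_filter_add_sum_filter_not P (fun m : ℕ × ℕ => m.1 < m.2)]
    rw [← Finset.sum_filter_add_sum_filter_not (P.filter fun m : ℕ × ℕ => ¬ m.1 < m.2)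
      (fun m : ℕ × ℕ => m.1 = m.2), Finset.filter_filter, Finset.filter_filter, add_assoc]
    congr 2
    · refine Finset.sum_congr (Finset.filter_congr fun m _ => ?_) fun _ _ => rfl
      omega
    · refine Finset.sum_congr (Finset.filter_congr fun m _ => ?_) fun _ _ => rfl
      omega
  -- the upper triangle equals the lower triangle
  have hsymm : ∑ m ∈ P.filter (fun m => m.2 < m.1), c m = ∑ m ∈ P.filter (fun m => m.1 < m.2), c m := by
    refine Finset.sum_nbij' Prod.swap Prod.swap (fun m hm => ?_) (fun m hm => ?_) (fun _ _ => rfl)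
      (fun _ _ => rfl) fun m _ => ?_
    · simp only [hP, Finset.mem_filter, Finset.mem_product] at hm ⊢
      exact ⟨⟨hm.1.2, hm.1.1⟩, hm.2⟩
    · simp only [hP, Finset.mem_filter, Finset.mem_product] at hm ⊢
      exact ⟨⟨hm.1.2, hm.1.1⟩, hm.2⟩
    · simp only [hc, Prod.fst_swap, Prod.snd_swap]
      rw [card_oddPrimePairsShift_comm]
  -- the three pieces
  have htri : ∑ m ∈ P.filter (fun m => m.1 < m.2), c m ≤ (4 + ε₁) * 2 * twinPrimeConst * W * ((L : ℝ) ^ 2 / 2 * romanovConstPR) := by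
    calc ∑ m ∈ P.filter (fun m => m.1 < m.2), c m
        ≤ ∑ m ∈ P.filter (fun m => m.1 < m.2), (4 + ε₁) * 2 * twinPrimeConst * fWeight (2 ^ m.2 - 2 ^ m.1) * W :=
          Finset.sum_le_sum hoff
      _ = (4 + ε₁) * 2 * twinPrimeConst * W * ∑ m ∈ P.filter (fun m => m.1 < m.2), fWeight (2 ^ m.2 - 2 ^ m.1) := by
          rw [Finset.mul_sum]
          refine Finset.sum_congr rfl fun m _ => ?_
          ring
      _ ≤ (4 + ε₁) * 2 * twinPrimeConst * W * ((L : ℝ) ^ 2 / 2 * romanovConstPR) :=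
          mul_le_mul_of_nonneg_left (sum_pairs_fWeight_le L) (by positivity)
  have hdiagsum : ∑ m ∈ P.filter (fun m => m.1 = m.2), c m ≤ (L : ℝ) * Nat.primeCounting N := by
    have hfd : P.filter (fun m : ℕ × ℕ => m.1 = m.2) = (Finset.Icc 1 L).image fun a => (a, a) := by
      ext ⟨a, b⟩
      simp only [hP, Finset.mem_filter, Finset.mem_product, Finset.mem_Icc, Finset.mem_image, Prod.mk.injEq]
      constructor
      · rintro ⟨⟨ha, -⟩, rfl⟩; exact ⟨a, ha, rfl, rfl⟩
      · rintro ⟨a', ha', rfl, rfl⟩; exact ⟨⟨ha', ha'⟩, rfl⟩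
    rw [hfd, Finset.sum_image fun a _ b _ h => by simpa using congrArg Prod.fst h]
    calc ∑ a ∈ Finset.Icc 1 L, c (a, a) ≤ ∑ a ∈ Finset.Icc 1 L, (Nat.primeCounting N : ℝ) := by
          refine Finset.sum_le_sum fun a _ => ?_
          simp only [hc]
          exact_mod_cast card_oddPrimePairsShift_self_le N a
      _ = (L : ℝ) * Nat.primeCounting N := by
          rw [Finset.sum_const, Nat.card_Icc, Nat.add_sub_cancel, nsmul_eq_mul]
  -- the diagonal against the main scale: `L π(N) ≤ (log 2 + ε) N L²/log² N`
  have hdiag' : (L : ℝ) * Nat.primeCounting N ≤ (Real.log 2 + ε) * ((L : ℝ) ^ 2 * W) := by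
    have hπ0 : (0 : ℝ) ≤ Nat.primeCounting N := Nat.cast_nonneg _
    have hlt : (Nat.primeCounting N : ℝ) * Real.log N / N * (Real.log N / L) < Real.log 2 + ε := hDg
    have heq : (Nat.primeCounting N : ℝ) * Real.log N / N * (Real.log N / L) * ((L : ℝ) ^ 2 * W) =
        (L : ℝ) * Nat.primeCounting N := by
      rw [hW]; field_simp
    rw [← heq]
    exact mul_le_mul_of_nonneg_right hlt.le (by positivity)
  -- assemble
  calc ∫ α in (0 : ℝ)..1, ‖primeSum N α * powSum N α‖ ^ 2
      = ((sgCoincidences N).card : ℝ) := integral_norm_sq_primeSum_mul_powSum N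
    _ = ∑ m ∈ P, c m := by
        rw [card_sgCoincidences_eq_sum]; push_cast; rfl
    _ = 2 * ∑ m ∈ P.filter (fun m => m.1 < m.2), c m + ∑ m ∈ P.filter (fun m => m.1 = m.2), c m := by
        rw [hsplit, hsymm]; ring
    _ ≤ 2 * ((4 + ε₁) * 2 * twinPrimeConst * W * ((L : ℝ) ^ 2 / 2 * romanovConstPR)) +
          (Real.log 2 + ε) * ((L : ℝ) ^ 2 * W) := by
        linarith [hdiagsum.trans hdiag', htri]
    _ = ((4 + ε₁) * 2 * K + (Real.log 2 + ε)) * ((L : ℝ) ^ 2 * W) := by rw [hK]; ring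
    _ ≤ (8 * K + ε + (Real.log 2 + ε)) * ((L : ℝ) ^ 2 * W) := by
        apply mul_le_mul_of_nonneg_right _ (by positivity)
        nlinarith
    _ = (4 * twinPrimeConst * romanovConstPR + Real.log 2 / 2 + ε) *
          (2 * (N : ℝ) * (powLen N : ℝ) ^ 2 / Real.log N ^ 2) := by
        rw [hK, hW, ← hLdef]; ring

end PintzRuzsa2003

end Literature.NumberTheory.Sieve

end
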